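import Literature.NumberTheory.IwasawaTheory.FukudaNakayamaFinite
import Mathlib.GroupTheory.Index
import Mathlib.GroupTheory.Commutator.Basic
import Mathlib.GroupTheory.SpecificGroups.Cyclic
import Mathlib.GroupTheory.GroupAction.ConjAct
import Mathlib.GroupTheory.PGroup
import HarnessLib

/-!
# Fukuda's Theorem 1 (1) — the GROUP-THEORETIC step at finite level (Washington §13.3, Lemmas 13.15 / 13.18, in a
# finite Galois group): `[G₁ : N₁] = [G : N₀] ⇒ [G : N₀] = #A`

Topic `NumberTheory/IwasawaTheory` (namespace = path). THEOREM file (two `[folklore]` plumbing definitions, no named fact, no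
`sorry`), written by the prover seat `bsd-potss-k8t-c4` g19 (cell `bsd-potss`; Fukuda road of stmt-BirchSwinnertonDyer-19982;
closes nothing). Brick (G) of the finite-level proof of the named fact `fukuda1994_thm1_classNumberPExp_const_of_succ_eq`
(`ClassicalMuInvariant.lean` §5) planned in `run/shared/lean/pub/bsd-potss/k8t-c4/g19/SCOPE-fukuda1994-thm1-holds-k8t-c4-g19.md`;
brick (N) is `FukudaNakayamaFinite.lean`.

THE SETTING (abstracting `G = Gal(H_p/K_n)`, `H_p` the `p`-Hilbert class field of `K_{n+2}`, `A = Gal(H_p/K_{n+2})`,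
`G₁ = Gal(H_p/K_{n+1})`, `𝓘` = the inertia groups of the primes of `H_p` over `K_n`): `G` a finite group, `A ◁ G` abelian (a `p`-group)
with `G/A` cyclic of order `p²`, `G₁` the subgroup of index `p` containing `A`, and a set `𝓘` of subgroups `I` with `I ∩ A = 1` and
`I = 1` or `IA = G` («unramified in `H_p/K_{n+2}`; unramified or totally ramified in `K_{n+2}/K_n`»), one of them with `IA = G`. Put
`N₀ = G'·⟨I : I ∈ 𝓘⟩` and `N₁ = G₁'·⟨I ∩ G₁ : I ∈ 𝓘⟩` (by class field theory `[G : N₀] = p^{e_n}`, `[G₁ : N₁] = p^{e_{n+1}}`,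
`#A = p^{e_{n+2}}` — brick (C), not here). THEOREM (`index_eq_card_of_relIndex_eq_index`): `[G₁ : N₁] = [G : N₀] ⇒ [G : N₀] = #A`.
PROOF (Washington Lemma 13.15: `G' = (σ−1)A`; Lemma 13.18: `Y₁ = ν Y₀`; Fukuda: Nakayama): with `σ` a generator of a totally ramified
`I₁` (so `G = A ⋊ ⟨σ⟩`, `σ^{p²} = 1`), `φ` = conjugation by `σ` on `A`, `D = φ − 1`, `ν = 1 + φ + ⋯ + φ^{p−1}`, `Y₀ = N₀ ∩ A`:
`Y₀` is `φ`-stable and contains `D(A)`; the subgroup `T = ν(Y₀)·⟨σ^p⟩` is normal, `A·T = G₁`, `T ∩ A = ν(Y₀)`, and `N₁ ≤ T`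
(`G₁' ≤ T` since `[aσ^{pi}, bσ^{pj}] ∈ (φ^{pj}−1)A·(φ^{pi}−1)A ⊆ ν D(A)`; `I ∩ G₁ = ⟨c^p⟩` for the generator `c = a_I σ` of `I`, and
`c^p = ν(a_I) σ^p` with `a_I ∈ Y₀`). Hence `#A/#Y₀ = [G : N₀] = [G₁ : N₁] ≥ [G₁ : T] = #A/#ν(Y₀)`, so `ν(Y₀) = Y₀` (`ν Y₀ ⊆ Y₀`), and
brick (N) (`FukudaNakayama.eq_bot_of_le_map_geom_sum`) gives `Y₀ = 1`, i.e. `[G : N₀] = #A`.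

References: [Washington1997] L. Washington, *Introduction to Cyclotomic Fields*, 2nd ed., §13.3 Lemmas 13.14–13.18, Prop. 13.22;
[Fukuda1994] T. Fukuda, Proc. Japan Acad. 70 A (1994), Thm. 1 (1) and its proof, p. 264.
-/

noncomputable section

open Subgroup Finset
open scoped IsMulCommutative commutatorElement

namespace Literature.NumberTheory.IwasawaTheory.FukudaGroup

variable {G : Type*} [Group G]

/-! ## §1 Conjugation on a normal abelian subgroup as a `ℤ`-linear endomorphism of `Additive A` -/

/-- Conjugation by `g` on the normal ABELIAN subgroup `A`, as a `ℤ`-linear endomorphism of `Additive A` (plumbing: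
`MulAut.conjNormal g` made additive; `A` is a `CommGroup` through the scoped `IsMulCommutative` instance). [folklore] -/
def conjEnd (A : Subgroup G) [A.Normal] [IsMulCommutative A] (g : G) : Module.End ℤ (Additive A) :=
  (MonoidHom.toAdditive (MulAut.conjNormal g : MulAut A).toMonoidHom).toIntLinearMap

/-- The subgroup `N ∩ A` of the abelian subgroup `A`, as a `ℤ`-submodule of `Additive A` (plumbing). [folklore] -/
def subOf (A : Subgroup G) [IsMulCommutative A] (N : Subgroup G) : Submodule ℤ (Additive A) :=
  (Subgroup.toAddSubgroup (N.subgroupOf A)).toIntSubmodule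

variable (A : Subgroup G) [A.Normal] [IsMulCommutative A]

/-- Unfolding `conjEnd`: `conjEnd A g (ofMul a) = ofMul (g a g⁻¹)`. [folklore] -/
@[simp] private theorem coe_toMul_conjEnd (g : G) (x : Additive A) :
    ((Additive.toMul (conjEnd A g x) : A) : G) = g * (Additive.toMul x : A) * g⁻¹ := rfl

omit [A.Normal] in
/-- Unfolding `subOf`: membership is membership of the underlying element in `N`. [folklore] -/
@[simp] private theorem mem_subOf {N : Subgroup G} {x : Additive A} : x ∈ subOf A N ↔ ((Additive.toMul x : A) : G) ∈ N := Iff.rfl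

omit [A.Normal] in
/-- `#(N ∩ A)` read on `subOf`. [folklore] -/
private theorem card_subOf (N : Subgroup G) : Nat.card (subOf A N) = Nat.card (N.subgroupOf A) :=
  Nat.card_congr (Equiv.subtypeEquiv Additive.toMul fun _ => Iff.rfl)

/-- `conjEnd` is multiplicative in `g`. [folklore] -/
private theorem conjEnd_mul (g h : G) : conjEnd A (g * h) = conjEnd A g * conjEnd A h := by
  apply LinearMap.ext; intro x
  apply Additive.toMul.injective; apply Subtype.ext
  simp only [coe_toMul_conjEnd, Module.End.mul_apply, mul_inv_rev, mul_assoc]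

/-- `conjEnd A 1 = 1`. [folklore] -/
private theorem conjEnd_one : conjEnd A (1 : G) = 1 := by
  apply LinearMap.ext; intro x
  apply Additive.toMul.injective; apply Subtype.ext
  simp only [coe_toMul_conjEnd, one_mul, inv_one, mul_one, Module.End.one_apply]

/-- `conjEnd A (g ^ n) = (conjEnd A g) ^ n`. [folklore] -/
private theorem conjEnd_pow (g : G) (n : ℕ) : conjEnd A (g ^ n) = conjEnd A g ^ n := by
  induction n with
  | zero => rw [pow_zero, pow_zero, conjEnd_one]
  | succ n ih => rw [pow_succ, conjEnd_mul, ih, pow_succ]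

/-- Conjugation by an element of the ABELIAN subgroup `A` is trivial on `A`. [folklore] -/
private theorem conjEnd_eq_one_of_mem {a : G} (ha : a ∈ A) : conjEnd A a = 1 := by
  apply LinearMap.ext; intro x
  apply Additive.toMul.injective; apply Subtype.ext
  rw [coe_toMul_conjEnd, Module.End.one_apply]
  rw [setLike_mul_comm ha (Additive.toMul x : A).2, mul_inv_cancel_right]

/-- **`(a g)^m = (a · φ(a) ⋯ φ^{m−1}(a)) · g^m`** for `a ∈ A`, `φ` = conjugation by `g` (Washington's `(aσ)^p = (ν a)σ^p`, proof of
Lemma 13.18), the product written additively as `(∑_{i<m} φ^i)(a)`. [cite: Washington1997, §13.3 Lemma 13.18 (proof)] -/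
theorem coe_mul_pow_eq (g : G) (a : A) (m : ℕ) :
    ((a : G) * g) ^ m = (Additive.toMul ((∑ i ∈ range m, conjEnd A g ^ i) (Additive.ofMul a)) : A) * g ^ m := by
  induction m with
  | zero => simp
  | succ m ih =>
    rw [pow_succ, ih, Finset.sum_range_succ, LinearMap.add_apply, toMul_add, Subgroup.coe_mul, ← conjEnd_pow,
      coe_toMul_conjEnd, toMul_ofMul, pow_succ]
    simp only [mul_assoc, inv_mul_cancel_left]

/-- The lift of a `ℤ`-submodule of `Additive A` back to a subgroup of `G` (plumbing). [folklore] -/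
def liftSub (S : Submodule ℤ (Additive A)) : Subgroup G :=
  (Subgroup.toAddSubgroup.symm S.toAddSubgroup).map A.subtype

omit [A.Normal] in
/-- Membership in `liftSub`. [folklore] -/
private theorem mem_liftSub {S : Submodule ℤ (Additive A)} {x : G} :
    x ∈ liftSub A S ↔ ∃ y : A, Additive.ofMul y ∈ S ∧ (y : G) = x := by
  constructor
  · rintro ⟨y, hy, rfl⟩
    exact ⟨y, hy, rfl⟩
  · rintro ⟨y, hy, rfl⟩
    exact ⟨y, hy, rfl⟩

omit [A.Normal] in
/-- `liftSub S ≤ A`. [folklore] -/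
private theorem liftSub_le (S : Submodule ℤ (Additive A)) : liftSub A S ≤ A := by
  rintro x hx
  obtain ⟨y, -, rfl⟩ := (mem_liftSub A).mp hx
  exact y.2

omit [A.Normal] in
/-- `#liftSub S = #S`. [folklore] -/
private theorem card_liftSub (S : Submodule ℤ (Additive A)) : Nat.card (liftSub A S) = Nat.card S := by
  rw [liftSub, Subgroup.card_map_of_injective (Subgroup.subtype_injective A)]
  exact Nat.card_congr (Equiv.subtypeEquiv Additive.ofMul fun _ => Iff.rfl)

omit [A.Normal] in
/-- `subOf (liftSub S) = S`-type bookkeeping: `liftSub (subOf N) = N ⊓ A`. [folklore] -/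
private theorem liftSub_subOf (N : Subgroup G) : liftSub A (subOf A N) = N ⊓ A := by
  ext x
  rw [mem_liftSub, Subgroup.mem_inf]
  constructor
  · rintro ⟨y, hy, rfl⟩
    exact ⟨(mem_subOf A).mp hy, y.2⟩
  · rintro ⟨hN, hA⟩
    exact ⟨⟨x, hA⟩, (mem_subOf A).mpr hN, rfl⟩

/-! ## §2 The commutator identity and the factorisation `φ^{pm} − 1 = ν ∘ (φ − 1) ∘ S_m` -/

omit [IsMulCommutative A] in
/-- `ofMul (g y g⁻¹) = conjEnd A g (ofMul y)` (unfolding). [folklore] -/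
private theorem ofMul_conjNormal [IsMulCommutative A] (g : G) (y : A) :
    Additive.ofMul (MulAut.conjNormal g y) = conjEnd A g (Additive.ofMul y) := rfl

/-- **Commutators in `A·⟨σ⟩`** (Washington Lemma 13.15, `G' = (σ−1)X`, at finite level): for `a, b ∈ A` and commuting `z, w ∈ G`,
`⁅a z, b w⁆ = a·(z b z⁻¹)·(w a w⁻¹)⁻¹·b⁻¹`, i.e. additively `(φ_z − 1)(b) − (φ_w − 1)(a)`.
[cite: Washington1997, §13.3 Lemma 13.15 (proof)] -/
theorem commutatorElement_eq (a b : A) {z w : G} (hzw : Commute z w) :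
    ⁅(a : G) * z, (b : G) * w⁆ =
      ((Additive.toMul ((conjEnd A z - 1) (Additive.ofMul b) - (conjEnd A w - 1) (Additive.ofMul a)) : A) : G) := by
  have step1 : ⁅(a : G) * z, (b : G) * w⁆ =
      ((a * MulAut.conjNormal z b * (MulAut.conjNormal w a)⁻¹ * b⁻¹ : A) : G) := by
    rw [commutatorElement_def, Subgroup.coe_mul, Subgroup.coe_mul, Subgroup.coe_mul, Subgroup.coe_inv, Subgroup.coe_inv,
      MulAut.conjNormal_apply, MulAut.conjNormal_apply]
    have hc : w * z⁻¹ = z⁻¹ * w := by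
      rw [eq_inv_mul_iff_mul_eq, ← mul_assoc, hzw.eq, mul_inv_cancel_right]
    simp only [mul_inv_rev, inv_inv, mul_assoc]
    rw [← mul_assoc w z⁻¹, hc, mul_assoc]
  have step2 : (a * MulAut.conjNormal z b * (MulAut.conjNormal w a)⁻¹ * b⁻¹ : A) =
      Additive.toMul ((conjEnd A z - 1) (Additive.ofMul b) - (conjEnd A w - 1) (Additive.ofMul a)) := by
    apply Additive.ofMul.injective
    rw [ofMul_toMul, ofMul_mul, ofMul_mul, ofMul_mul, ofMul_inv, ofMul_inv, ofMul_conjNormal, ofMul_conjNormal,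
      LinearMap.sub_apply, LinearMap.sub_apply, Module.End.one_apply, Module.End.one_apply]
    abel
  rw [step1, step2]

/-- The special case `⁅g, a⁆ = (φ − 1)(a)` (`a ∈ A`). [cite: Washington1997, §13.3 Lemma 13.15] -/
theorem commutatorElement_eq' (g : G) (a : A) :
    ⁅g, (a : G)⁆ = ((Additive.toMul ((conjEnd A g - 1) (Additive.ofMul a)) : A) : G) := by
  rw [LinearMap.sub_apply, Module.End.one_apply, toMul_sub, toMul_ofMul, Subgroup.coe_div, coe_toMul_conjEnd,
    toMul_ofMul, commutatorElement_def, div_eq_mul_inv]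

omit [A.Normal] [IsMulCommutative A] in
/-- **`φ^{pm} − 1 = N_φ ∘ (φ − 1) ∘ S_m`** with `N_φ = 1 + φ + ⋯ + φ^{p−1}`, `S_m = 1 + φ^p + ⋯ + φ^{p(m−1)}` (twice `geom_sum_mul`;
Washington Lemma 13.18: `Y_n = ν_n Y₀`). [cite: Washington1997, §13.3 Lemma 13.18 (proof)] -/
theorem pow_mul_sub_one_eq {M : Type*} [AddCommGroup M] (φ : Module.End ℤ M) (p m : ℕ) :
    φ ^ (p * m) - 1 = (∑ i ∈ range p, φ ^ i) * ((φ - 1) * ∑ t ∈ range m, (φ ^ p) ^ t) := by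
  rw [← mul_assoc, geom_sum_mul, mul_geom_sum, ← pow_mul]

/-! ## §3 The structure lemmas and the main theorem -/

section Main

variable {A} [Finite G] {p : ℕ} [hp : Fact p.Prime]

omit [IsMulCommutative A] hp in
/-- Every element of `G = A ⊔ ⟨g⟩` is `a g^n` with `a ∈ A`, `n ∈ ℕ` (finite group). [folklore] -/
private theorem exists_eq_mul_pow {g : G} (hgen : A ⊔ Subgroup.zpowers g = ⊤) (x : G) :
    ∃ a : A, ∃ n : ℕ, x = (a : G) * g ^ n := by
  have hx : x ∈ A ⊔ Subgroup.zpowers g := by rw [hgen]; exact Subgroup.mem_top x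
  rw [Subgroup.mem_sup_of_normal_left] at hx
  obtain ⟨y, hy, z, hz, rfl⟩ := hx
  rw [← mem_powers_iff_mem_zpowers] at hz
  obtain ⟨n, rfl⟩ := hz
  exact ⟨⟨y, hy⟩, n, rfl⟩

omit [A.Normal] [IsMulCommutative A] [Finite G] hp in
/-- If `⟨g⟩ ∩ A = 1` then `g^n ∈ A ⇒ g^n = 1`. [folklore] -/
private theorem pow_eq_one_of_mem {g : G} (hgA : Subgroup.zpowers g ⊓ A = ⊥) {n : ℕ} (hn : g ^ n ∈ A) : g ^ n = 1 := by
  have : g ^ n ∈ Subgroup.zpowers g ⊓ A := ⟨Subgroup.npow_mem_zpowers g n, hn⟩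
  rwa [hgA, Subgroup.mem_bot] at this

omit [A.Normal] [IsMulCommutative A] [Finite G] hp in
/-- A subgroup containing the commutator subgroup is normal. [folklore] -/
private theorem normal_of_commutator_le {N : Subgroup G} (hN : ⁅(⊤ : Subgroup G), ⊤⁆ ≤ N) : N.Normal := by
  refine ⟨fun n hn x => ?_⟩
  have hc : ⁅x, n⁆ ∈ N := hN (Subgroup.commutator_mem_commutator (Subgroup.mem_top x) (Subgroup.mem_top n))
  have : x * n * x⁻¹ = ⁅x, n⁆ * n := by rw [commutatorElement_def, inv_mul_cancel_right]
  rw [this]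
  exact N.mul_mem hc hn

omit [IsMulCommutative A] hp in
/-- `[K : T] · #(T ∩ A) = #A` whenever `A ◁ G` and `A ⊔ T = K` (cardinality bookkeeping behind `[G : N₀] = [A : Y₀]`). [folklore] -/
private theorem relIndex_mul_card_inf_eq {T K : Subgroup G} (hT : T ≤ K) (hAK : A ≤ K) (hsup : A ⊔ T = K) :
    T.relIndex K * Nat.card ↥(T ⊓ A) = Nat.card A := by
  -- `[K : A] = [T : T ∩ A]`
  have h1 : A.relIndex K = A.relIndex T := by rw [← hsup, sup_comm, Subgroup.relIndex_sup_right]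
  -- `[K : A] · #A = #K`, `[K : T] · #T = #K`, `[T : T∩A] · #(T∩A) = #T`
  have hA : A.relIndex K * Nat.card A = Nat.card K := by
    rw [Subgroup.relIndex, mul_comm, ← Nat.card_congr (Subgroup.subgroupOfEquivOfLe hAK).toEquiv, Subgroup.card_mul_index]
  have hTK : T.relIndex K * Nat.card T = Nat.card K := by
    rw [Subgroup.relIndex, mul_comm, ← Nat.card_congr (Subgroup.subgroupOfEquivOfLe hT).toEquiv, Subgroup.card_mul_index]
  have hTA : A.relIndex T * Nat.card ↥(T ⊓ A) = Nat.card T := by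
    rw [Subgroup.relIndex, mul_comm, ← Subgroup.inf_subgroupOf_left,
      ← Nat.card_congr (Subgroup.subgroupOfEquivOfLe (inf_le_left : T ⊓ A ≤ T)).toEquiv, Subgroup.card_mul_index]
  have hpos : 0 < A.relIndex T := Nat.pos_of_ne_zero (by rw [Subgroup.relIndex]; exact Subgroup.index_ne_zero_of_finite)
  -- combine
  have key : A.relIndex T * (T.relIndex K * Nat.card ↥(T ⊓ A)) = A.relIndex T * Nat.card A := by
    calc A.relIndex T * (T.relIndex K * Nat.card ↥(T ⊓ A))
        = T.relIndex K * (A.relIndex T * Nat.card ↥(T ⊓ A)) := by ring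
      _ = T.relIndex K * Nat.card T := by rw [hTA]
      _ = Nat.card K := hTK
      _ = A.relIndex K * Nat.card A := hA.symm
      _ = A.relIndex T * Nat.card A := by rw [h1]
  exact Nat.eq_of_mul_eq_mul_left hpos key

/-- **The algebraic Fukuda step (Thm. 1 (1) at finite level, group-theoretic part).** Let `G` be finite, `A ◁ G` abelian of
`p`-power order with `G/A` cyclic of order `p²`, `G₁ ≥ A` the subgroup of index `p`, and `𝓘` a set of subgroups with `I ∩ A = 1`
and `I = 1` or `I·A = G` for each `I ∈ 𝓘`, some `I ∈ 𝓘` having `I·A = G`. With `N₀ = G'·⟨I : I ∈ 𝓘⟩` and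
`N₁ = G₁'·⟨I ∩ G₁ : I ∈ 𝓘⟩`: if `[G₁ : N₁] = [G : N₀]` then `[G : N₀] = #A`. (In the application `G = Gal(H_p/K_n)`,
`[G : N₀] = p^{e_n}`, `[G₁ : N₁] = p^{e_{n+1}}`, `#A = p^{e_{n+2}}`: «`e_{n+1} = e_n ⇒ e_{n+2} = e_n`».)
[cite: Fukuda1994, Thm. 1 (1), p. 264 (proof)] [cite: Washington1997, §13.3 Lemmas 13.15, 13.18, Prop. 13.22] -/
theorem index_eq_card_of_relIndex_eq_index (hApg : IsPGroup p A) (hind : A.index = p ^ 2)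
    (hcyc : IsCyclic (G ⧸ A)) (𝓘 : Set (Subgroup G))
    (h𝓘 : ∀ I ∈ 𝓘, I ⊓ A = ⊥ ∧ (I = ⊥ ∨ I ⊔ A = ⊤)) (h𝓘₁ : ∃ I ∈ 𝓘, I ⊔ A = ⊤)
    (G₁ : Subgroup G) (hAG₁ : A ≤ G₁) (hG₁ : G₁.index = p)
    (h : (⁅G₁, G₁⁆ ⊔ ⨆ I ∈ 𝓘, I ⊓ G₁).relIndex G₁ = (⁅(⊤ : Subgroup G), ⊤⁆ ⊔ ⨆ I ∈ 𝓘, I).index) :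
    (⁅(⊤ : Subgroup G), ⊤⁆ ⊔ ⨆ I ∈ 𝓘, I).index = Nat.card A := by
  classical
  set N₀ : Subgroup G := ⁅(⊤ : Subgroup G), ⊤⁆ ⊔ ⨆ I ∈ 𝓘, I with hN₀
  set N₁ : Subgroup G := ⁅G₁, G₁⁆ ⊔ ⨆ I ∈ 𝓘, I ⊓ G₁ with hN₁
  have hp1 : 1 < p := hp.out.one_lt
  have hp0 : 0 < p := hp.out.pos
  -- the quotient `G/A`: a generator `γ` of order `p²`
  have hcardQ : Nat.card (G ⧸ A) = p ^ 2 := by rw [← Subgroup.index_eq_card, hind]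
  obtain ⟨γ, hγ⟩ := IsCyclic.exists_generator (α := G ⧸ A)
  have hγord : orderOf γ = p ^ 2 := by rw [orderOf_eq_card_of_forall_mem_zpowers hγ, hcardQ]
  -- every element of `G/A` is a natural power of `γ`
  have hγpow : ∀ q : G ⧸ A, ∃ j : ℕ, γ ^ j = q := fun q =>
    ((isOfFinOrder_of_finite γ).mem_powers_iff_mem_zpowers.mpr (hγ q))
  -- `G' ≤ A` (the quotient is cyclic, hence commutative)
  have hcommA : ⁅(⊤ : Subgroup G), ⊤⁆ ≤ A := by
    rw [← commutator_def, ← Subgroup.Normal.quotient_commutative_iff_commutator_le]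
    refine ⟨⟨fun x y => ?_⟩⟩
    obtain ⟨i, rfl⟩ := hγpow x
    obtain ⟨j, rfl⟩ := hγpow y
    rw [← pow_add, ← pow_add, add_comm]
  -- the generator `g ∈ I₁` lifting `γ`
  obtain ⟨I₁, hI₁𝓘, hI₁⟩ := h𝓘₁
  have hI₁A : I₁ ⊓ A = ⊥ := (h𝓘 I₁ hI₁𝓘).1
  -- lift of `γ` inside a subgroup `I` with `I ⊔ A = ⊤`
  have lift : ∀ I : Subgroup G, I ⊔ A = ⊤ → ∀ x : G, ∃ c ∈ I, ∃ a ∈ A, c = a * x ∧ (c : G ⧸ A) = (x : G ⧸ A) := by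
    intro I hI x
    have hx : x ∈ I ⊔ A := by rw [hI]; exact Subgroup.mem_top x
    rw [Subgroup.mem_sup_of_normal_right] at hx
    obtain ⟨c, hc, z, hz, hcz⟩ := hx
    refine ⟨c, hc, x * z⁻¹ * x⁻¹, ‹A.Normal›.conj_mem _ (A.inv_mem hz) x, ?_, ?_⟩
    · rw [← hcz]; group
    · rw [← hcz, QuotientGroup.mk_mul, (QuotientGroup.eq_one_iff z).mpr hz, mul_one]
  obtain ⟨γ₀, rfl⟩ := QuotientGroup.mk_surjective γ
  obtain ⟨g, hgI₁, a₀, -, -, hgγ⟩ := lift I₁ hI₁ γ₀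
  -- from now on `γ = mk g`
  rw [← hgγ] at hγ hγord hγpow
  -- `⟨g⟩ ∩ A = 1`, `g^{p²} = 1`, `orderOf g = p²`, `A ⊔ ⟨g⟩ = G`
  have hgA : Subgroup.zpowers g ⊓ A = ⊥ := by
    rw [eq_bot_iff, ← hI₁A]
    exact inf_le_inf_right A ((Subgroup.zpowers_le).mpr hgI₁)
  have hgpow_mem : ∀ n : ℕ, g ^ n ∈ A → g ^ n = 1 := fun n hn => pow_eq_one_of_mem hgA hn
  have hgord' : g ^ (p ^ 2) = 1 := by
    apply hgpow_mem
    rw [← QuotientGroup.eq_one_iff, QuotientGroup.mk_pow, ← hγord, pow_orderOf_eq_one]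
  have hgord : orderOf g = p ^ 2 := by
    refine Nat.dvd_antisymm (orderOf_dvd_of_pow_eq_one hgord') ?_
    rw [← hγord]
    exact orderOf_map_dvd (QuotientGroup.mk' A) g
  have hgen : A ⊔ Subgroup.zpowers g = ⊤ := by
    rw [eq_top_iff]
    intro x _
    obtain ⟨j, hj⟩ := hγpow x
    rw [← QuotientGroup.mk_pow, QuotientGroup.eq] at hj
    -- `(g^j)⁻¹ * x ∈ A`
    have : x = g ^ j * ((g ^ j)⁻¹ * x) := by group
    rw [this, sup_comm]
    exact Subgroup.mul_mem_sup (Subgroup.npow_mem_zpowers g j) hj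
  -- `G₁`: normal, `x^p ∈ G₁` for every `x`, `p`-th powers of its elements lie in `A`, its elements are `a (g^p)^m`
  haveI hG₁n : G₁.Normal := normal_of_commutator_le (hcommA.trans hAG₁)
  have hG₁card : Nat.card (G ⧸ G₁) = p := by rw [← Subgroup.index_eq_card, hG₁]
  have hpow_mem_G₁ : ∀ x : G, x ^ p ∈ G₁ := fun x => by
    rw [← QuotientGroup.eq_one_iff, QuotientGroup.mk_pow, ← hG₁card]; exact pow_card_eq_one'
  have hrelG₁ : A.relIndex G₁ = p := by
    have h1 := Subgroup.relIndex_mul_index hAG₁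
    rw [hind, hG₁, pow_two] at h1
    exact Nat.eq_of_mul_eq_mul_right hp0 h1
  have hG₁pow : ∀ x ∈ G₁, x ^ p ∈ A := by
    intro x hx
    have hc : Nat.card (G₁ ⧸ A.subgroupOf G₁) = p := by rw [← Subgroup.index_eq_card, ← Subgroup.relIndex, hrelG₁]
    have h1 : ((⟨x, hx⟩ : G₁) : G₁ ⧸ A.subgroupOf G₁) ^ p = 1 := by rw [← hc]; exact pow_card_eq_one'
    rw [← QuotientGroup.mk_pow, QuotientGroup.eq_one_iff, Subgroup.mem_subgroupOf, Subgroup.coe_pow] at h1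
    exact h1
  have hG₁elt : ∀ x ∈ G₁, ∃ a : A, ∃ m : ℕ, x = (a : G) * g ^ (p * m) := by
    intro x hx
    obtain ⟨a, n, rfl⟩ := exists_eq_mul_pow hgen x
    have hgn : g ^ n ∈ G₁ := by
      have h1 := G₁.mul_mem (G₁.inv_mem (hAG₁ a.2)) hx
      rwa [inv_mul_cancel_left] at h1
    have hnp : g ^ (n * p) = 1 := hgpow_mem _ (by rw [pow_mul]; exact hG₁pow _ hgn)
    have hdvd : p ^ 2 ∣ n * p := hgord ▸ orderOf_dvd_of_pow_eq_one hnp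
    rw [pow_two] at hdvd
    obtain ⟨m, hm⟩ := Nat.dvd_of_mul_dvd_mul_right hp0 hdvd
    exact ⟨a, m, by rw [hm]⟩
  -- the endomorphism `φ` = conjugation by `g` on `Additive A`, the submodule `Y₀ = N₀ ∩ A`, and `ν`
  set φ : Module.End ℤ (Additive A) := conjEnd A g with hφ
  have hφpow : φ ^ (p ^ 2) = 1 := by rw [hφ, ← conjEnd_pow, hgord', conjEnd_one]
  set Y₀ : Submodule ℤ (Additive A) := subOf A N₀ with hY₀
  have hN₀comm : ⁅(⊤ : Subgroup G), ⊤⁆ ≤ N₀ := le_sup_left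
  haveI hN₀n : N₀.Normal := normal_of_commutator_le hN₀comm
  have hIN₀ : ∀ I ∈ 𝓘, I ≤ N₀ := fun I hI =>
    le_sup_of_le_right (le_iSup₂ (f := fun I (_ : I ∈ 𝓘) => I) I hI)
  have hgN₀ : g ∈ N₀ := hIN₀ I₁ hI₁𝓘 hgI₁
  have hDY : ∀ x : Additive A, (φ - 1) x ∈ Y₀ := by
    intro x
    rw [hY₀, mem_subOf, hφ]
    have h1 := commutatorElement_eq' A g (Additive.toMul x)
    rw [ofMul_toMul] at h1
    rw [← h1]
    exact hN₀comm (Subgroup.commutator_mem_commutator (Subgroup.mem_top g) (Subgroup.mem_top _))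
  have hYstab : ∀ y ∈ Y₀, φ y ∈ Y₀ := by
    intro y hy
    rw [hY₀, mem_subOf] at hy ⊢
    rw [hφ, coe_toMul_conjEnd]
    exact hN₀n.conj_mem _ hy g
  have hYstab_pow : ∀ n : ℕ, ∀ y ∈ Y₀, (φ ^ n) y ∈ Y₀ := by
    intro n
    induction n with
    | zero => intro y hy; simpa using hy
    | succ n ih => intro y hy; rw [pow_succ', Module.End.mul_apply]; exact hYstab _ (ih y hy)
  set ν : Module.End ℤ (Additive A) := ∑ i ∈ range p, φ ^ i with hν
  have hνY : ∀ y ∈ Y₀, ν y ∈ Y₀ := by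
    intro y hy
    rw [hν, LinearMap.sum_apply]
    exact Y₀.sum_mem fun i _ => hYstab_pow i y hy
  have hνcomm : ∀ n : ℕ, φ ^ n * ν = ν * φ ^ n := fun n =>
    (Commute.sum_right _ _ _ fun i _ => Commute.pow_pow_self φ n i).eq
  -- `(φ^{pm} − 1) x ∈ ν(Y₀)` (Washington Lemma 13.18)
  have hkey : ∀ (m : ℕ) (x : Additive A), (φ ^ (p * m) - 1) x ∈ Y₀.map ν := by
    intro m x
    rw [pow_mul_sub_one_eq φ p m, ← hν, Module.End.mul_apply]
    exact Submodule.mem_map_of_mem (by rw [Module.End.mul_apply]; exact hDY _)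
  -- the subgroup `L` = lift of `ν(Y₀)`, normal, and `T = L ⊔ ⟨g^p⟩`
  set L : Subgroup G := liftSub A (Y₀.map ν) with hL
  have hLA : L ≤ A := liftSub_le A _
  have hmemL : ∀ y ∈ Y₀.map ν, ((Additive.toMul y : A) : G) ∈ L := fun y hy =>
    (mem_liftSub A).mpr ⟨Additive.toMul y, by simpa using hy, rfl⟩
  haveI hLn : L.Normal := by
    refine ⟨fun l hl x => ?_⟩
    obtain ⟨y, hy, rfl⟩ := (mem_liftSub A).mp hl
    obtain ⟨a, n, rfl⟩ := exists_eq_mul_pow hgen x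
    have h1 : g ^ n * (y : G) * (g ^ n)⁻¹ ∈ L := by
      have h2 : ((Additive.toMul ((φ ^ n) (Additive.ofMul y)) : A) : G) = g ^ n * y * (g ^ n)⁻¹ := by
        rw [hφ, ← conjEnd_pow, coe_toMul_conjEnd, toMul_ofMul]
      rw [← h2]
      apply hmemL
      obtain ⟨y', hy', hyy'⟩ := Submodule.mem_map.mp hy
      rw [← hyy', ← Module.End.mul_apply, hνcomm, Module.End.mul_apply]
      exact Submodule.mem_map_of_mem (hYstab_pow n y' hy')
    have h2 : (a : G) * (g ^ n * y * (g ^ n)⁻¹) * (a : G)⁻¹ = g ^ n * y * (g ^ n)⁻¹ := by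
      rw [setLike_mul_comm a.2 (hLA h1), mul_inv_cancel_right]
    rw [show (a : G) * g ^ n * ↑y * ((a : G) * g ^ n)⁻¹ = (a : G) * (g ^ n * y * (g ^ n)⁻¹) * (a : G)⁻¹ by group, h2]
    exact h1
  set T : Subgroup G := L ⊔ Subgroup.zpowers (g ^ p) with hT
  have hTA : T ⊓ A = L := by
    apply le_antisymm
    · intro x hx
      obtain ⟨hxT, hxA⟩ := Subgroup.mem_inf.mp hx
      rw [hT, Subgroup.mem_sup_of_normal_left] at hxT
      obtain ⟨l, hl, z, hz, rfl⟩ := hxT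
      obtain ⟨k, rfl⟩ := Subgroup.mem_zpowers_iff.mp hz
      have hzA : (g ^ p) ^ k ∈ A := by
        have h1 := A.mul_mem (A.inv_mem (hLA hl)) hxA
        rwa [inv_mul_cancel_left] at h1
      have hz1 : (g ^ p) ^ k = 1 := by
        have hmem : (g ^ p) ^ k ∈ Subgroup.zpowers g ⊓ A :=
          ⟨by rw [← zpow_natCast, ← zpow_mul]; exact Subgroup.zpow_mem_zpowers g _, hzA⟩
        rwa [hgA, Subgroup.mem_bot] at hmem
      rw [hz1, mul_one]
      exact hl
    · exact le_inf le_sup_left hLA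
  have hgpG₁ : g ^ p ∈ G₁ := hpow_mem_G₁ g
  have hAT : A ⊔ T = G₁ := by
    apply le_antisymm
    · exact sup_le hAG₁ (sup_le (hLA.trans hAG₁) ((Subgroup.zpowers_le).mpr hgpG₁))
    · intro x hx
      obtain ⟨a, m, rfl⟩ := hG₁elt x hx
      refine Subgroup.mul_mem_sup a.2 ?_
      rw [pow_mul]
      exact Subgroup.mem_sup_right (Subgroup.npow_mem_zpowers (g ^ p) m)
  -- `N₁ ≤ T`
  have hN₁T : N₁ ≤ T := by
    rw [hN₁]
    refine sup_le ?_ (iSup₂_le fun I hI => ?_)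
    · rw [Subgroup.commutator_le]
      intro x hx y hy
      obtain ⟨a, m₁, rfl⟩ := hG₁elt x hx
      obtain ⟨b, m₂, rfl⟩ := hG₁elt y hy
      rw [commutatorElement_eq A a b ((Commute.refl g).pow_pow _ _)]
      refine Subgroup.mem_sup_left (hmemL _ ?_)
      rw [conjEnd_pow, conjEnd_pow, ← hφ]
      exact Submodule.sub_mem _ (hkey m₁ _) (hkey m₂ _)
    · obtain ⟨hIA, hI0 | hI0⟩ := h𝓘 I hI
      · rw [hI0, bot_inf_eq]; exact bot_le
      · obtain ⟨c, hcI, aI, haI, hcaI, hcγ⟩ := lift I hI0 g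
        have haIN₀ : aI ∈ N₀ := by
          have h1 : aI = c * g⁻¹ := by rw [hcaI, mul_inv_cancel_right]
          rw [h1]
          exact N₀.mul_mem (hIN₀ I hI hcI) (N₀.inv_mem hgN₀)
        have hcpow_mem : ∀ n : ℕ, c ^ n ∈ A → c ^ n = 1 := fun n hn => by
          have h1 : c ^ n ∈ I ⊓ A := ⟨I.pow_mem hcI n, hn⟩
          rwa [hIA, Subgroup.mem_bot] at h1
        have hcord : orderOf c = p ^ 2 := by
          refine Nat.dvd_antisymm (orderOf_dvd_of_pow_eq_one (hcpow_mem _ ?_)) ?_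
          · rw [← QuotientGroup.eq_one_iff, QuotientGroup.mk_pow, hcγ, ← hγord, pow_orderOf_eq_one]
          · rw [← hγord, ← hcγ]; exact orderOf_map_dvd (QuotientGroup.mk' A) c
        rintro x ⟨hxI, hxG₁⟩
        obtain ⟨j, hj⟩ := hγpow x
        rw [← hcγ, ← QuotientGroup.mk_pow, QuotientGroup.eq] at hj
        have hxcj : x = c ^ j := by
          have hmem : (c ^ j)⁻¹ * x ∈ I ⊓ A := ⟨I.mul_mem (I.inv_mem (I.pow_mem hcI j)) hxI, hj⟩
          rw [hIA, Subgroup.mem_bot, inv_mul_eq_one] at hmem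
          exact hmem.symm
        have hcjp : c ^ (j * p) = 1 := hcpow_mem _ (by rw [pow_mul, ← hxcj]; exact hG₁pow x hxG₁)
        have hdvd : p ^ 2 ∣ j * p := hcord ▸ orderOf_dvd_of_pow_eq_one hcjp
        rw [pow_two] at hdvd
        obtain ⟨j', hj'⟩ := Nat.dvd_of_mul_dvd_mul_right hp0 hdvd
        have hcp : c ^ p ∈ T := by
          have h1 : c = ((⟨aI, haI⟩ : A) : G) * g := hcaI
          rw [h1, coe_mul_pow_eq A g ⟨aI, haI⟩ p]
          refine Subgroup.mul_mem_sup (hmemL _ ?_) (Subgroup.mem_zpowers _)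
          rw [← hφ, ← hν]
          exact Submodule.mem_map_of_mem ((mem_subOf A).mpr haIN₀)
        rw [hxcj, hj', pow_mul]
        exact T.pow_mem hcp j'
  -- cardinalities: `[G : N₀]·#(N₀ ∩ A) = #A = [G₁ : T]·#L`, `[G₁ : T] ∣ [G₁ : N₁] = [G : N₀]`
  have hcount₀ : N₀.index * Nat.card ↥(N₀ ⊓ A) = Nat.card A := by
    have h1 := relIndex_mul_card_inf_eq (A := A) (T := N₀) (K := ⊤) le_top le_top
      (by rw [eq_top_iff, ← hgen]; exact sup_le le_sup_left ((Subgroup.zpowers_le).mpr (Subgroup.mem_sup_right hgN₀)))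
    rwa [Subgroup.relIndex_top_right] at h1
  have hcountT : T.relIndex G₁ * Nat.card L = Nat.card A := by
    have h1 := relIndex_mul_card_inf_eq (A := A) (T := T) (K := G₁) (hAT ▸ le_sup_right) hAG₁ hAT
    rwa [hTA] at h1
  have hdvdT : T.relIndex G₁ ∣ N₀.index := by
    have h1 := Subgroup.relIndex_dvd_of_le_left G₁ hN₁T
    rwa [h] at h1
  have hcardY : Nat.card ↥(N₀ ⊓ A) = Nat.card Y₀ := by rw [← liftSub_subOf, card_liftSub]
  have hcardL : Nat.card L = Nat.card (Y₀.map ν) := card_liftSub A _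
  have hle : Nat.card Y₀ ≤ Nat.card (Y₀.map ν) := by
    obtain ⟨k, hk⟩ := hdvdT
    have hTpos : 0 < T.relIndex G₁ :=
      Nat.pos_of_ne_zero (by rw [Subgroup.relIndex]; exact Subgroup.index_ne_zero_of_finite)
    have hk0 : 0 < k := by
      rcases Nat.eq_zero_or_pos k with h0 | h0
      · exfalso; rw [h0, mul_zero] at hk; exact Subgroup.index_ne_zero_of_finite hk
      · exact h0
    have h1 : T.relIndex G₁ * Nat.card L = T.relIndex G₁ * (k * Nat.card ↥(N₀ ⊓ A)) := by
      rw [hcountT, ← hcount₀, hk, mul_assoc]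
    have h2 := Nat.eq_of_mul_eq_mul_left hTpos h1
    rw [hcardL, hcardY] at h2
    rw [h2]
    exact Nat.le_mul_of_pos_left _ hk0
  -- `ν(Y₀) = Y₀`, then Nakayama
  have hνle : Y₀.map ν ≤ Y₀ := Submodule.map_le_iff_le_comap.mpr fun y hy => hνY y hy
  have hνeq : Y₀.map ν = Y₀ :=
    SetLike.coe_injective (Set.Finite.eq_of_subset_of_card_le (Set.toFinite _) hνle hle)
  have hApg' : ∃ a, Nat.card (Additive A) = p ^ a := by
    obtain ⟨a, ha⟩ := IsPGroup.iff_card.mp hApg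
    exact ⟨a, ha⟩
  have hY₀bot : Y₀ = ⊥ := FukudaNakayama.eq_bot_of_le_map_geom_sum 2 hApg' φ hφpow Y₀ hYstab fun y hy => by
    rw [← hνeq] at hy
    obtain ⟨y', hy', rfl⟩ := Submodule.mem_map.mp hy
    exact ⟨y', hy', rfl⟩
  have hone : Nat.card ↥(N₀ ⊓ A) = 1 := by
    rw [hcardY, hY₀bot]
    exact Nat.card_unique
  rw [hone, mul_one] at hcount₀
  exact hcount₀

end Main

end Literature.NumberTheory.IwasawaTheory.FukudaGroup

end
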